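import Summits.Ventures.PercRepro.MSTwin
import Summits.Ventures.PercRepro.MSTightProduct

/-!
# The class-level flip: a tight family with the class dichotomy is a product

`MSTightProduct.lean` shows that a tight family whose difference family is a down-set is, after
flipping along its addable class `M`, a product of two down-sets on `u \ M` and `M`. That argument
only used the down-set property of the flip for *twin-closed* subsets. This file runs it at the
level of twin classes, for a family `G` satisfying the **class dichotomy** (`Dichotomy G`: every
twin class is addable or removable — the conclusion of Lemmas A and B of Theorem S,
proofs/MINE1-theoremS.md): with `Rstar G` the union of the addable classes,

* the flip `flip (Rstar G) G` is closed under removing twin-closed sets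
  (`sdiff_mem_flip_of_twinClosed`, `mem_flip_of_subset_of_twinClosed`);
* `G \\ G = within (flip) (univ \ Rstar G) ⊻ within (flip) (Rstar G)`
  (`diffs_eq_sups_within_of_dichotomy`), and by counting the flip IS that product
  (`flip_eq_sups_within_of_dichotomy`) for tight `G`; hence `G \\ G = flip (Rstar G) G`
  (`diffs_eq_flip_of_dichotomy`) and the flip is closed under recombining the two sides
  (`union_mem_flip_of_dichotomy`);
* consequences: `Rstar G ∈ G`; `G` is **convex on twin-closed sets**
  (`mem_of_subset_of_subset_of_twinClosed`: `x ⊆ z ⊆ y` with `x, y ∈ G` and `z` twin-closed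
  forces `z ∈ G`); and the general mixed-cell lemma `mem_or_compl_mem_of_dichotomy` — the
  statement `TLGeneral` of `MS3RegimeTL.lean` for families with the class dichotomy, obtained by
  evaluating the hypothesis at the member `Rstar G`.
-/

namespace PercRepro.MSTight

open Finset
open scoped FinsetFamily symmDiff

variable {α : Type*} [DecidableEq α] [Fintype α]

/-- The **class dichotomy**: every twin class of `G` is addable or removable. -/
def Dichotomy (G : Finset (Finset α)) : Prop :=
  ∀ a, ClosedAdd G (cls G a) ∨ ClosedRem G (cls G a)

/-- The **addable part**: the elements whose twin class is addable. -/
def Rstar (G : Finset (Finset α)) : Finset α := Finset.univ.filter fun a => ClosedAdd G (cls G a)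

/-- Membership in the addable part. -/
theorem mem_Rstar {G : Finset (Finset α)} {a : α} : a ∈ Rstar G ↔ ClosedAdd G (cls G a) := by
  simp [Rstar]

/-- The addable part is twin-closed. -/
theorem twinClosed_Rstar (G : Finset (Finset α)) : TwinClosed G (Rstar G) := by
  intro a b hab ha
  rw [mem_Rstar] at ha ⊢
  rwa [← cls_eq_of_twin hab]

/-- Under the dichotomy, the classes outside the addable part are removable. -/
theorem closedRem_of_notMem_Rstar {G : Finset (Finset α)} (hG : Dichotomy G) {a : α}
    (ha : a ∉ Rstar G) : ClosedRem G (cls G a) :=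
  (hG a).resolve_left fun h => ha (mem_Rstar.2 h)

/-- Members of the flip along the addable part are twin-closed. -/
theorem twinClosed_of_mem_flip {G : Finset (Finset α)} {W : Finset α}
    (hW : W ∈ flip (Rstar G) G) : TwinClosed G W := by
  obtain ⟨A, hA, rfl⟩ := mem_flip.1 hW
  exact (twinClosed_of_mem hA).symmDiff (twinClosed_Rstar G)

/-- **(PS1)** The flip is closed under removing a twin class. -/
theorem sdiff_cls_mem_flip {G : Finset (Finset α)} (hG : Dichotomy G) {W : Finset α}
    (hW : W ∈ flip (Rstar G) G) (a : α) : W \ cls G a ∈ flip (Rstar G) G := by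
  obtain ⟨A, hA, rfl⟩ := mem_flip.1 hW
  by_cases ha : a ∈ Rstar G
  · have hcl : cls G a ⊆ Rstar G := cls_subset_of_twinClosed (twinClosed_Rstar G) ha
    refine mem_flip.2 ⟨A ∪ cls G a, mem_Rstar.1 ha A hA, ?_⟩
    ext x
    simp only [mem_symmDiff, mem_sdiff, mem_union]
    by_cases hx : x ∈ cls G a
    · have hxR : x ∈ Rstar G := hcl hx
      simp [hx, hxR]
    · simp [hx]
  · have hdisj : Disjoint (cls G a) (Rstar G) :=
      disjoint_cls_of_twinClosed_of_notMem (twinClosed_Rstar G) ha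
    refine mem_flip.2 ⟨A \ cls G a, closedRem_of_notMem_Rstar hG ha A hA, ?_⟩
    ext x
    simp only [mem_symmDiff, mem_sdiff]
    by_cases hx : x ∈ cls G a
    · have hxR : x ∉ Rstar G := Finset.disjoint_left.1 hdisj hx
      simp [hx, hxR]
    · simp [hx]

/-- The flip is closed under removing a twin-closed set. -/
theorem sdiff_mem_flip_of_twinClosed {G : Finset (Finset α)} (hG : Dichotomy G) {W : Finset α}
    (hW : W ∈ flip (Rstar G) G) {Z : Finset α} (hZ : TwinClosed G Z) :
    W \ Z ∈ flip (Rstar G) G :=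
  sdiff_mem_of_forall_sdiff_cls_mem (P := G) (G := flip (Rstar G) G) Z hZ
    (fun a _ _ hW' => sdiff_cls_mem_flip hG hW' a) W hW

/-- The flip contains every twin-closed subset of a member. -/
theorem mem_flip_of_subset_of_twinClosed {G : Finset (Finset α)} (hG : Dichotomy G)
    {W W' : Finset α} (hW : W ∈ flip (Rstar G) G) (hW' : W' ⊆ W) (htc : TwinClosed G W') :
    W' ∈ flip (Rstar G) G := by
  have := sdiff_mem_flip_of_twinClosed hG hW ((twinClosed_of_mem_flip hW).sdiff htc)
  rwa [Finset.sdiff_sdiff_eq_self hW'] at this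

/-- The differences of `G` are exactly the unions `X ∪ Y` of a flipped member `X` outside
`Rstar G` and a flipped member `Y` inside `Rstar G`. -/
theorem diffs_eq_sups_within_of_dichotomy {G : Finset (Finset α)} (hG : Dichotomy G) :
    G \\ G = within (flip (Rstar G) G) (Finset.univ \ Rstar G) ⊻
      within (flip (Rstar G) G) (Rstar G) := by
  set M := Rstar G with hM
  have hMtc : TwinClosed G M := twinClosed_Rstar G
  ext E
  constructor
  · intro hE
    obtain ⟨A, hA, B, hB, rfl⟩ := mem_diffs.1 hE
    have hA' := symmDiff_mem_flip (M := M) hA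
    have hB' := symmDiff_mem_flip (M := M) hB
    have htA := twinClosed_of_mem_flip hA'
    have htB := twinClosed_of_mem_flip hB'
    rw [sdiff_eq_of_symmDiff A B M]
    refine mem_sups.2 ⟨_, mem_within.2 ⟨mem_flip_of_subset_of_twinClosed hG hA' ?_ ?_, ?_⟩,
      _, mem_within.2 ⟨mem_flip_of_subset_of_twinClosed hG hB' ?_ ?_, ?_⟩, sup_eq_union⟩
    · exact sdiff_subset.trans sdiff_subset
    · exact (htA.sdiff htB).sdiff hMtc
    · intro s hs
      exact mem_sdiff.2 ⟨mem_univ _, (mem_sdiff.1 hs).2⟩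
    · exact inter_subset_left.trans sdiff_subset
    · exact (htB.sdiff htA).inter hMtc
    · exact inter_subset_right
  · intro hE
    obtain ⟨X, hX, Y, hY, rfl⟩ := mem_sups.1 hE
    obtain ⟨hXG, hXN⟩ := mem_within.1 hX
    obtain ⟨hYG, hYM⟩ := mem_within.1 hY
    refine mem_diffs.2 ⟨X ∆ M, symmDiff_mem_of_mem_flip hXG, Y ∆ M, symmDiff_mem_of_mem_flip hYG, ?_⟩
    rw [sdiff_eq_of_symmDiff (X ∆ M) (Y ∆ M) M, symmDiff_symmDiff_cancel_right,
      symmDiff_symmDiff_cancel_right, sup_eq_union]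
    ext s
    simp only [mem_union, mem_sdiff, mem_inter]
    constructor
    · rintro (⟨⟨hs, _⟩, _⟩ | ⟨⟨hs, _⟩, _⟩)
      · exact Or.inl hs
      · exact Or.inr hs
    · rintro (hs | hs)
      · have hsM : s ∉ M := (mem_sdiff.1 (hXN hs)).2
        exact Or.inl ⟨⟨hs, fun h => hsM (hYM h)⟩, hsM⟩
      · have hsM : s ∈ M := hYM hs
        exact Or.inr ⟨⟨hs, fun h => (mem_sdiff.1 (hXN h)).2 hsM⟩, hsM⟩

/-- **The flip is the product** for a tight family with the class dichotomy. -/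
theorem flip_eq_sups_within_of_dichotomy {G : Finset (Finset α)} (hG : Dichotomy G)
    (hT : Tight G) :
    flip (Rstar G) G = within (flip (Rstar G) G) (Finset.univ \ Rstar G) ⊻
      within (flip (Rstar G) G) (Rstar G) := by
  set M := Rstar G with hM
  have hMtc : TwinClosed G M := twinClosed_Rstar G
  apply eq_of_subset_of_card_le
  · intro W hW
    have htW := twinClosed_of_mem_flip hW
    refine mem_sups.2 ⟨W ∩ (Finset.univ \ M), mem_within.2 ⟨mem_flip_of_subset_of_twinClosed hG hW
      inter_subset_left (htW.inter ((twinClosed_univ G).sdiff hMtc)), inter_subset_right⟩,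
      W ∩ M, mem_within.2 ⟨mem_flip_of_subset_of_twinClosed hG hW inter_subset_left
      (htW.inter hMtc), inter_subset_right⟩, ?_⟩
    rw [sup_eq_union]
    ext s
    simp only [mem_union, mem_inter, mem_sdiff, mem_univ, true_and]
    constructor
    · rintro (⟨hs, _⟩ | ⟨hs, _⟩) <;> exact hs
    · intro hs
      by_cases hsM : s ∈ M
      · exact Or.inr ⟨hs, hsM⟩
      · exact Or.inl ⟨hs, hsM⟩
  · rw [← diffs_eq_sups_within_of_dichotomy hG, card_flip]
    exact le_of_eq hT

/-- **(PS3)** The differences of a tight family with the class dichotomy are exactly the flipped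
members: `G \\ G = flip (Rstar G) G`. -/
theorem diffs_eq_flip_of_dichotomy {G : Finset (Finset α)} (hG : Dichotomy G) (hT : Tight G) :
    G \\ G = flip (Rstar G) G := by
  rw [diffs_eq_sups_within_of_dichotomy hG, ← flip_eq_sups_within_of_dichotomy hG hT]

/-- **(PS2)** The flip is closed under recombining the addable part of one member with the
removable part of another. -/
theorem union_mem_flip_of_dichotomy {G : Finset (Finset α)} (hG : Dichotomy G) (hT : Tight G)
    {W V : Finset α} (hW : W ∈ flip (Rstar G) G) (hV : V ∈ flip (Rstar G) G) :
    (W ∩ Rstar G) ∪ (V \ Rstar G) ∈ flip (Rstar G) G := by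
  have htW := twinClosed_of_mem_flip hW
  have htV := twinClosed_of_mem_flip hV
  have hMtc : TwinClosed G (Rstar G) := twinClosed_Rstar G
  rw [flip_eq_sups_within_of_dichotomy hG hT]
  refine mem_sups.2 ⟨V \ Rstar G, mem_within.2 ⟨mem_flip_of_subset_of_twinClosed hG hV
    sdiff_subset (htV.sdiff hMtc), fun s hs => mem_sdiff.2 ⟨mem_univ _, (mem_sdiff.1 hs).2⟩⟩,
    W ∩ Rstar G, mem_within.2 ⟨mem_flip_of_subset_of_twinClosed hG hW inter_subset_left
    (htW.inter hMtc), inter_subset_right⟩, ?_⟩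
  rw [sup_eq_union, union_comm]

/-- The addable part is a member of every nonempty family with the class dichotomy. -/
theorem Rstar_mem_of_dichotomy {G : Finset (Finset α)} (hG : Dichotomy G) (hne : G.Nonempty) :
    Rstar G ∈ G := by
  obtain ⟨A, hA⟩ := hne
  have h1 : A ∪ Rstar G ∈ G :=
    union_mem_of_closedAdd (twinClosed_Rstar G) (fun a ha => mem_Rstar.1 ha) hA
  have h2 : (A ∪ Rstar G) \ (A \ Rstar G) ∈ G :=
    sdiff_mem_of_closedRem ((twinClosed_of_mem hA).sdiff (twinClosed_Rstar G))
      (fun a ha => closedRem_of_notMem_Rstar hG (mem_sdiff.1 ha).2) h1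
  have e : (A ∪ Rstar G) \ (A \ Rstar G) = Rstar G := by
    ext x
    simp only [mem_sdiff, mem_union]
    tauto
  rwa [e] at h2

/-- A member of the flip flipped back is a member. -/
theorem mem_of_symmDiff_mem_flip {G : Finset (Finset α)} {z : Finset α}
    (h : z ∆ Rstar G ∈ flip (Rstar G) G) : z ∈ G := by
  have := symmDiff_mem_of_mem_flip h
  rwa [symmDiff_symmDiff_cancel_right] at this

/-- **Convexity on twin-closed sets.** For a tight family with the class dichotomy, a twin-closed
set sandwiched between two members is a member. -/
theorem mem_of_subset_of_subset_of_twinClosed {G : Finset (Finset α)} (hG : Dichotomy G)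
    (hT : Tight G) {x y z : Finset α} (hx : x ∈ G) (hy : y ∈ G) (hxz : x ⊆ z) (hzy : z ⊆ y)
    (hz : TwinClosed G z) : z ∈ G := by
  set M := Rstar G with hM
  have hx' : x ∆ M ∈ flip M G := symmDiff_mem_flip hx
  have hy' : y ∆ M ∈ flip M G := symmDiff_mem_flip hy
  have hW : x ∆ M \ (z \ x) ∈ flip M G :=
    sdiff_mem_flip_of_twinClosed hG hx' (hz.sdiff (twinClosed_of_mem hx))
  have hV : y ∆ M \ (y \ z) ∈ flip M G :=
    sdiff_mem_flip_of_twinClosed hG hy' ((twinClosed_of_mem hy).sdiff hz)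
  have hU := union_mem_flip_of_dichotomy hG hT hW hV
  have e : (x ∆ M \ (z \ x)) ∩ M ∪ (y ∆ M \ (y \ z)) \ M = z ∆ M := by
    ext s
    simp only [mem_union, mem_inter, mem_sdiff, mem_symmDiff]
    have h1 := @hxz s
    have h2 := @hzy s
    tauto
  rw [e] at hU
  exact mem_of_symmDiff_mem_flip hU

/-- **The general mixed-cell lemma for families with the class dichotomy.** If every member `t`
of a tight nonempty `G` has both agreement cells `t ∩ w`, `tᶜ ∩ wᶜ` or both disagreement cells
`t ∩ wᶜ`, `tᶜ ∩ w` among the differences, then `w` or `wᶜ` is a member — evaluate at the member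
`Rstar G`. -/
theorem mem_or_compl_mem_of_dichotomy {G : Finset (Finset α)} (hG : Dichotomy G) (hT : Tight G)
    (hne : G.Nonempty) (w : Finset α)
    (hcond : ∀ t ∈ G, (t ∩ w ∈ G \\ G ∧ (Finset.univ \ t) ∩ (Finset.univ \ w) ∈ G \\ G) ∨
      (t ∩ (Finset.univ \ w) ∈ G \\ G ∧ (Finset.univ \ t) ∩ w ∈ G \\ G)) :
    w ∈ G ∨ Finset.univ \ w ∈ G := by
  set M := Rstar G with hM
  have hD : G \\ G = flip M G := diffs_eq_flip_of_dichotomy hG hT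
  rw [hD] at hcond
  rcases hcond M (Rstar_mem_of_dichotomy hG hne) with ⟨h1, h2⟩ | ⟨h1, h2⟩
  · right
    have hU := union_mem_flip_of_dichotomy hG hT h1 h2
    have e : (M ∩ w) ∩ M ∪ ((Finset.univ \ M) ∩ (Finset.univ \ w)) \ M = (Finset.univ \ w) ∆ M := by
      ext s
      simp only [mem_union, mem_inter, mem_sdiff, mem_symmDiff, mem_univ, true_and]
      tauto
    rw [e] at hU
    exact mem_of_symmDiff_mem_flip hU
  · left
    have hU := union_mem_flip_of_dichotomy hG hT h1 h2
    have e : (M ∩ (Finset.univ \ w)) ∩ M ∪ ((Finset.univ \ M) ∩ w) \ M = w ∆ M := by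
      ext s
      simp only [mem_union, mem_inter, mem_sdiff, mem_symmDiff, mem_univ, true_and]
      tauto
    rw [e] at hU
    exact mem_of_symmDiff_mem_flip hU

end PercRepro.MSTight
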